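import Summits.ABC.IUTFork.LDHCor312Skel
import Summits.ABC.IUTFork.Cor312StatementBridge
import HarnessLib

/-!
# The fork at [IUTchIII] Corollary 3.12 — the VERBATIM form (c312-7) and the DUPUY–HILADO form (c312-3), bridged

Record-only file (D-0012) of the abc-iut cell (Cor. 3.12 sub-crew, wave 2, seat abc-iut-c312-6, board row W2-C, the
D-0060 (3) deliverable "`Cor312` (DH form and the verbatim form)"); TAKES NO SIDE. Both forms now live over the
skeleton's `Cor312Setting` (XVII): the verbatim statement `Cor312.Setting.Statement` (c312-7, over c312-1's Thm. 3.11
situation and L6-t4's Def. 3.8 / Prop. 3.9 / Rmk. 3.9.5 nouns) via `Cor312Vol.toCor312Setting` / `statement_iff_cor312`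
(`Cor312StatementBridge`), and Dupuy–Hilado's (1.1) `DHData.Cor312DH` via `DHData.toSetting` / `cor312_iff_cor312DH`
(`LDHCor312Skel`). Composing through `Cor312Vol.cor312_iff_of_agreement`:

* `statement_iff_cor312DH` — **[IUTchIII] Cor. 3.12 as printed ↔ Dupuy–Hilado (1.1)**, MODULO the named identification
  `VerbatimDHAgreement (toCor312Setting H) D.toSetting` of the two settings' `−|log(Θ)|` and `−|log(q)|`, which
  `agreement_iff` unfolds to the two equations `P.negLogTheta = ↑(ln ν̄_𝕃(hull U_Θ))` and `P.negLogQ = ln ν̄_𝕃(O_𝕃(−P_q))`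
  between c312-7's numbers and c312-3's (Dupuy–Hilado §1 p. 3: "`𝕃` … is abstractly isomorphic to a space that appears in
  [IUT3]"). What the identification must absorb is listed in `Cor312Bridge`'s docstring (IUT's section `𝕍 ≅ 𝕍_mod` vs DH's
  average over all places; archimedean `v_ℚ`; the normalisations agree summand-by-summand: `verbatim_weight_eq_dh_weight`).
* consequently the Dupuy–Hilado CALIBRATION (`ForkInflation`: `cor312_iff_inflation`, `free_inequality`, the squeeze) and
  c312-3's `cor312DH_iff_inflation` speak about the printed statement under the same identification
  (`statement_iff_inflationDH`).

[claim: Mochizuki2012, status: disputed] [cite: DupuyHilado2025, §1 (1.1) pp. 3–4]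
Deliberately NOT here: a PROOF of the identification in a common model (campaign work: the tensor-packet measures of
[IUTchIV] Prop. 1.1–1.4, seats S1/S2, against `AdelicPacketModel`); any judgement.
-/

noncomputable section

namespace Summit.ABC

namespace IUTFork

namespace Cor312Vol

open Thm311 Cor312 Literature.IUT.LogVolume

variable {T : ThetaIndex} {S : Situation T} {P : Cor312.Setting S}
variable {F : Type} [Field F] [NumberField F]

/-- The named identification between the verbatim setting and a Dupuy–Hilado setting, UNFOLDED: it says exactly
that c312-7's `−|log(Θ)|` is (the real number) `[F:ℚ] · ln ν̄_𝕃(hull(U_Θ))` of c312-3 and c312-7's `−|log(q)|` is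
`[F:ℚ] · ln ν̄_𝕃(O_𝕃(−P_q))` — c312-3's skeleton setting carries DH's NORMALISED log-volumes (`deĝ̲ = deĝ/[F:ℚ]`,
Dupuy–Hilado §2.5.4) rescaled by the degree `[F:ℚ]` (`DHData.negLogTheta_eq`, `negAbsLogq_eq'`).
[cite: DupuyHilado2025, §1 pp. 3–4, §2.5.4] -/
theorem agreement_iff (H : BridgeHyps P) (D : DHData F) :
    VerbatimDHAgreement (toCor312Setting H) D.toSetting ↔
      P.negLogTheta = (((Module.finrank ℚ F : ℝ) * D.negLogThetaDH : ℝ) : WithTop ℝ) ∧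
        P.negLogQ = (Module.finrank ℚ F : ℝ) * D.negAbsLogqDH := by
  rw [← toCor312Setting_negLogTheta H, ← toCor312Setting_negAbsLogq H, ← D.negLogTheta_eq, ← D.negAbsLogq_eq',
    WithTop.coe_inj]
  exact ⟨fun h => ⟨h.hull_logvol, h.q_logvol⟩, fun h => ⟨h.1, h.2⟩⟩

/-- **[IUTchIII] Cor. 3.12 as printed (c312-7) ↔ Dupuy–Hilado (1.1) (c312-3), modulo the named identification.**
Neither side is asserted; the theorem is the bookkeeping that the two typed forms of the disputed inequality are the
same proposition once the two pairs of numbers are identified. [cite: DupuyHilado2025, §1 (1.1)] -/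
theorem statement_iff_cor312DH (H : BridgeHyps P) (D : DHData F)
    (hA : VerbatimDHAgreement (toCor312Setting H) D.toSetting) : P.Statement ↔ D.Cor312DH :=
  (statement_iff_cor312 H).trans ((cor312_iff_of_agreement hA).trans D.cor312_iff_cor312DH)

/-- Under the identification, the printed statement is Dupuy–Hilado's INFLATION condition: the indeterminacies and
the hull inflate `O_𝕃(−P_Θ)` by at least `deĝ̲_lgp(P_Θ) − deĝ̲(P_q)` (c312-3 `cor312DH_iff_inflation`; skeleton XVIII
`cor312_iff_inflation`). [claim: Mochizuki2012, status: disputed] -/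
theorem statement_iff_inflationDH (H : BridgeHyps P) (D : DHData F)
    (hA : VerbatimDHAgreement (toCor312Setting H) D.toSetting) :
    P.Statement ↔ LgpDivisor.ndegLgp D.X.thetaPilot - FinDivisor.ndeg F D.X.qPilot ≤
      D.negLogThetaDH - D.M.lnνL D.X.lstar D.T (D.M.region D.tΘ) :=
  (statement_iff_cor312DH H D hA).trans D.cor312DH_iff_inflation

/-- In the other direction of use: a Dupuy–Hilado datum whose (1.1) FAILS and which is identified with the verbatim
setting refutes the printed statement for that setting — and vice versa (`LDHWitness` has both truth values of
(1.1) over `ℚ`-valued toy models; whether any DH datum IS so identified with a setting arising from Thm. 3.11 is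
exactly what is not decided here). [folklore] -/
theorem not_statement_iff_not_cor312DH (H : BridgeHyps P) (D : DHData F)
    (hA : VerbatimDHAgreement (toCor312Setting H) D.toSetting) : ¬ P.Statement ↔ ¬ D.Cor312DH :=
  not_congr (statement_iff_cor312DH H D hA)

/-! ## One-directional bridges (no `BridgeHyps`, no equality of `−|log(Θ)|`)

DISCLOSURE (RQ7 note R7-C3-N3, seat abc-iut-L6-t24, 2026-08-25T21:45Z, on Dupuy–Hilado §4.9/§4.11 "the (COARSE)
multiradial representation" vs [IUTchIII] Thm. 3.11 (i) (Ind2) p. 154 "independent copies of Ism … on each of the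
direct summands"): a Dupuy–Hilado datum whose `U_Θ` is built from the COARSE `φ`-group `Aut_{ℚ_p}(K_{v⃗} : I_{v⃗})`
([IUTchIV] Prop. 1.2; DH §4.9) contains the verbatim union of possible images, so — same measure, hull monotone — one
expects `P.negLogTheta ≤ [F:ℚ]·ln ν̄_𝕃(hull(U_Θ^coarse))`, an INEQUALITY, not the equality that
`VerbatimDHAgreement` / `agreement_iff` / `statement_iff_cor312DH` take as hypothesis. The equality-based `iff`
above therefore needs a "coarse hull-volume = fine hull-volume" theorem that nobody claims, and may be a vacuous
hypothesis for the real instances. The two theorems below are the bridges every downstream consumer actually uses: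
the printed statement IMPLIES (1.1) under the inequality `hΘ` and agreement of the `q`-sides, and conversely (1.1)
implies the printed statement under the opposite inequality; neither needs `BridgeHyps`. [cite: DupuyHilado2025, §4.9, §4.11]
-/

/-- **Printed statement ⟹ Dupuy–Hilado (1.1), one-directional** (R7-C3-N3): if c312-7's `−|log(Θ)|` is AT MOST
`[F:ℚ]·ln ν̄_𝕃(hull(U_Θ))` of the DH datum (e.g. because `U_Θ` is Dupuy–Hilado's COARSE union, §4.11, containing the
verbatim union of possible images) and the two `−|log(q)|` agree up to the rescaling `[F:ℚ]`
(`DHData.negAbsLogq_eq'`), then `P.Statement → D.Cor312DH`. No `BridgeHyps`, no equality of hull-volumes.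
[cite: DupuyHilado2025, §1 (1.1), §4.11] -/
theorem cor312DH_of_statement_of_le (D : DHData F)
    (hΘ : P.negLogTheta ≤ (((Module.finrank ℚ F : ℝ) * D.negLogThetaDH : ℝ) : WithTop ℝ))
    (hq : P.negLogQ = (Module.finrank ℚ F : ℝ) * D.negAbsLogqDH) (h : P.Statement) : D.Cor312DH := by
  rw [DHData.cor312DH_iff_logvol]
  have hF := FinDivisor.finrank_pos (F := F)
  have hle : ((P.negLogQ : ℝ) : WithTop ℝ) ≤ (((Module.finrank ℚ F : ℝ) * D.negLogThetaDH : ℝ) : WithTop ℝ) :=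
    h.2.trans hΘ
  rw [WithTop.coe_le_coe, hq] at hle
  exact le_of_mul_le_mul_left hle hF

/-- **Dupuy–Hilado (1.1) ⟹ printed statement, one-directional**: if c312-7's `−|log(Θ)|` is finite and AT
LEAST `[F:ℚ]·ln ν̄_𝕃(hull(U_Θ))` of the DH datum, and the `q`-sides agree, then `D.Cor312DH → P.Statement`.
(With both inequalities, i.e. equality, this and `cor312DH_of_statement_of_le` recover `statement_iff_cor312DH`
without `BridgeHyps`.) [cite: DupuyHilado2025, §1 (1.1)] -/
theorem statement_of_cor312DH_of_le (D : DHData F) (hfin : P.negLogTheta ≠ ⊤)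
    (hΘ : (((Module.finrank ℚ F : ℝ) * D.negLogThetaDH : ℝ) : WithTop ℝ) ≤ P.negLogTheta)
    (hq : P.negLogQ = (Module.finrank ℚ F : ℝ) * D.negAbsLogqDH) (h : D.Cor312DH) : P.Statement := by
  rw [DHData.cor312DH_iff_logvol] at h
  have hF := FinDivisor.finrank_pos (F := F)
  refine ⟨hfin, le_trans ?_ hΘ⟩
  rw [WithTop.coe_le_coe, hq]
  exact mul_le_mul_of_nonneg_left h hF.le

/-- The equality-based agreement is the conjunction of the two inequalities used above (so the `iff` bridge is
the meet of the two one-directional ones; which inequality a given real instance satisfies is exactly the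
coarse-vs-fine question of R7-C3-N3, not decided here). [folklore] -/
theorem agreement_iff_le_antisymm (H : BridgeHyps P) (D : DHData F) :
    VerbatimDHAgreement (toCor312Setting H) D.toSetting ↔
      (P.negLogTheta ≤ (((Module.finrank ℚ F : ℝ) * D.negLogThetaDH : ℝ) : WithTop ℝ) ∧
        (((Module.finrank ℚ F : ℝ) * D.negLogThetaDH : ℝ) : WithTop ℝ) ≤ P.negLogTheta) ∧
      P.negLogQ = (Module.finrank ℚ F : ℝ) * D.negAbsLogqDH := by
  rw [agreement_iff H D, le_antisymm_iff]

end Cor312Vol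

end IUTFork

end Summit.ABC

end
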